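/-
Origin: expansion seat `planner-pub-hodgecm-pv12-g3-0`, handover #3 v2 2026-08-18T05:28:15Z (`HOME/pub-hodgecm-pv12-g3/lean/Pv12g3/ArchCKernelDictionary.lean`, md5 84bb0436, 190 lines);
landed by the gen-6 packager in gate run 23 as `HodgeCM/PerL34/ArchCKernelDictionary.lean` (verbatim).
-/
/-
Origin: HOME/pub-hodgecm-pv12-g3/lean/Pv12g3/ArchCKernelDictionary.lean — session planner-pub-hodgecm-pv12-g3-0 (unit
pub-hodgecm-pv12-g3, DAG-node prover #12 gen 3), LEMMAS.md v8 §9 seam S4 residual "+ N21".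
Intended final place: `HodgeCM/PerL34/ArchCKernelDictionary.lean`, namespace `HodgeCM.PerL34.ArchC`.
Imports LANDED / run-22-staged modules only: `HodgeCM.PerL34.KernelOperatorFDEquiv` (pv05-g2, run 22, verbatim) and
`HodgeCM.Prior.Perl34` (frozen).  No WIP import to rewrite.  Asserts nothing: no axiom, no placeholder proof.
-/
import Summits.HodgeConjecture.HodgeCM.PerL34.KernelOperatorFDEquiv
import Summits.HodgeConjecture.HodgeCM.Prior.Perl34_5

set_option autoImplicit false

/-!
# Seam S4, the `[NODE N21]` field: `invariance` from the L²-kernel shell through an explicit dictionary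

CONTEXT.  After `ArchCFockAnalytic.lean` (this seat, run 22) the S4 bridge record `ArchC.FockAnalyticBridge C D P`
(and pv06's consumed `ArchC.ArchCDatum C D P`, field `invariance`, `ArchC.lean` :273) still carries ONE field whose
type is a NODE of the DAG rather than set-up / dictionary data:

  `invariance : ∀ (h : G) (Φ : SK) (v : H), C.TΦc (C.omg h Φ) (C.R h v) = C.TΦc Φ v`

— [PerL] v5 §3.3, ll. 382–383: "`𝒯_{ω(h₀)Φ}(R(h₀)v) = 𝒯_Φ(v)` for `h₀ ∈ U(W)(𝔸)`, `R` the right regular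
representation" (DAG node N21, second sentence; LEMMAS v8 §9 S4: "residual = set-up + K-type tables (PRINT) + N21").
Its mathematical content is PROVED in the tree at the L²-kernel shell level: pv05 `KernelOperator.opT_comp_eq`
(run 19, continuous kernels on compact `X × Y`) and pv05-g2 `KernelOperatorFD.evalT_comp_eq` / `opT_comp_eq`
(run 22, fundamental-domain model: bounded kernel, finite measure) — "if `τ` preserves `ν` and
`k'(x, y) = k(x, τ y)` then `𝒯_{k'}(v ∘ τ) = 𝒯_k(v)`".  What separates that theorem from the field over Prior's
frozen `IsolationCore` is exactly the MODEL DICTIONARY D4 (LEMMAS §3): "`𝒯_Φ` IS the kernel operator of `θ_Φ`",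
"`R(h)` IS right translation by `h`", "`θ_{ω(h)Φ}(g, y) = θ_Φ(g, y·h)`" (tex l. 383 / l. 414).

THIS FILE types that dictionary as a record `ArchC.KernelDictionary C` — every field a [DICTIONARY D4] reading of one
of Prior's carried constants `C.TΦc`, `C.R`, `C.omg` in the fundamental-domain shell of `KernelOperatorFD`, or the
right-Haar-invariance of the quotient measure (l. 382) — and PROVES

  `KernelDictionary.invariance (K : KernelDictionary C) : ∀ h Φ v, C.TΦc (C.omg h Φ) (C.R h v) = C.TΦc Φ v`

BY NAME from pv05-g2 `KernelOperatorFD.evalT_comp_eq`.  Hence the `invariance` field of `FockAnalyticBridge` /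
`ArchCDatum` may be supplied as `K.invariance`: after this file no field of the S4 record has the type of a DAG-node
INFERENCE — what it posits is [SETUP D4/D5/D7] structure of the intended model, [DICTIONARY D4] readings (this
record), the [NODE N26 / DICTIONARY] identification line `w_loc` (the node's content — the vacuum exponents
`e_b(Ψ_i)` — is pv01's kernel `ArchBookkeeping.N26_holds`; the field is the dictionary half "the Fock character IS
the archimedean type"), PRINT K-type tables, and the [DEFINITIONAL] reading `wOccurs_of_eigenvector`.

FIELDS OF `KernelDictionary` WITH LABEL AND SOURCE:
  [DICTIONARY D4]  `X` (= the points of [G_U] at which values of `𝒯_Φ v ∈ C([G_U])` are read), `eCG : CG → X → ℂ`,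
                   `eCG_injective` (an element of C([G_U]) is determined by its values — Prior's `CG` is an abstract
                   normed space, D1);
  [DICTIONARY D4]  `Y`, `ν` (a fundamental domain for U(W)(L₀)\U(W)(𝔸) with the quotient of `dh`, as in pv14 `P36FD`
                   / pv05-g2 `KernelOperatorFD`), `eH : H → Lp ℂ 2 ν` (a vector of L²([U(W)]) read as an L²-class
                   on the domain);
  [DICTIONARY D4]  `θ : SK → X → Y → ℂ` (the theta kernel `θ_Φ(g, h)`, l. 376–379) and
                   `hT : eCG (C.TΦc Φ v) x = KernelOperatorFD.evalT (θ Φ) ν (eH v) x` — "`(𝒯_Φ v)(g) :=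
                   ∫_{[U(W)]} θ_Φ(g,h) v(h) dh`" (l. 380), i.e. Prior's carried `TΦc` IS the kernel operator;
  [DICTIONARY D4]  `τ h : Y → Y` (right translation by `h` transported to the domain), `hτe` (a measurable
                   embedding — it is a bijection), `hR : eH (C.R h v) = Lp.compMeasurePreserving (τ h) (hτ h) (eH v)`
                   — Prior's carried `R` IS the right regular representation (AX9, l. 382);
  [SETUP, l. 382]  `hτ h : MeasurePreserving (τ h) ν ν` — right-invariance of the quotient measure `dh` on the
                   compact quotient (the unitarity `C.R_unitary` Prior already carries is the same fact read in H);
  [DICTIONARY D4 / tex l. 383, l. 414]  `hθ : θ (C.omg h Φ) x y = θ Φ x (τ h y)` — "`θ_{ω(h₀)Φ}(g, h) =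
                   θ_Φ(g, h h₀)`", the change of variables in the theta series (automorphy of `θ` in the second
                   variable is built into reading it on the quotient).

NOT PROVED HERE, AND NOT CLAIMED: the construction of such a dictionary for PerL's adelic theta model (an
instantiated `ThetaModel`; LEMMAS §3 D4 — a formalisation programme, not an inference of the paper).  The record is
plainly satisfiable (§2: an instance over the linear one-point toy, `X = Y = Unit`, Dirac measure), so
`KernelDictionary.invariance` is not vacuously true.
-/

noncomputable section

open MeasureTheory
open HodgeCM.Prior.Perl34File HodgeCM.Prior.Perl34File.Perl34

namespace HodgeCM
namespace PerL34
namespace ArchC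

variable {H HG CG G SK SigIdx SigIdxG : Type*}
  [NormedAddCommGroup H] [InnerProductSpace ℂ H] [CompleteSpace H]
  [NormedAddCommGroup HG] [InnerProductSpace ℂ HG] [CompleteSpace HG]
  [NormedAddCommGroup CG] [NormedSpace ℂ CG]
  [Group G] [TopologicalSpace G] [TopologicalSpace SK]

/-! ## §1 The dictionary record and the by-name discharge of `invariance` -/

/-- **[DICTIONARY D4] The theta model's `(H, R, CG, 𝒯, ω)` read in the L²-kernel shell** (fundamental-domain
model of pv05-g2 `KernelOperatorFD`).  Every field is a reading of one of Prior's carried constants or the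
right-invariance of `dh`; see the module docstring for the label and tex line of each. -/
structure KernelDictionary (C : IsolationCore H HG CG G SK SigIdx SigIdxG) where
  /-- [D4] the points of `[G_U]`. -/
  X : Type
  /-- [D4] reading an element of `CG = C([G_U])` as a function on the points. -/
  eCG : CG → X → ℂ
  /-- [D4] a continuous function on `[G_U]` is determined by its values. -/
  eCG_injective : Function.Injective eCG
  /-- [D4] a fundamental domain for `U(W)(L₀)\U(W)(𝔸)` … -/
  Y : Type
  /-- … with its Borel structure … -/
  [instMY : MeasurableSpace Y]
  /-- … and the quotient of the Haar measure `dh`. -/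
  ν : Measure Y
  /-- [D4] reading a vector of `H = L²([U(W)])` as an `L²`-class on the domain. -/
  eH : H → Lp ℂ 2 ν
  /-- [D4] the theta kernel `θ_Φ(g, h)` (tex ll. 376–379), as a function of `(g, h) ∈ X × Y`. -/
  θ : SK → X → Y → ℂ
  /-- [D4, tex l. 380] `(𝒯_Φ v)(g) = ∫_{[U(W)]} θ_Φ(g, h) v(h) dh`: Prior's carried `TΦc` IS the kernel operator. -/
  hT : ∀ (Φ : SK) (v : H) (x : X), eCG (C.TΦc Φ v) x = KernelOperatorFD.evalT (θ Φ) ν (eH v) x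
  /-- [D4] right translation by `h ∈ U(W)(𝔸)` transported to the domain. -/
  τ : G → Y → Y
  /-- [SETUP, tex l. 382] right-invariance of `dh`: `τ h` preserves `ν`. -/
  hτ : ∀ h : G, MeasurePreserving (τ h) ν ν
  /-- [D4] `τ h` is a measurable embedding (it is a measurable bijection). -/
  hτe : ∀ h : G, MeasurableEmbedding (τ h)
  /-- [D4, AX9 l. 382] Prior's carried `R` IS the right regular representation: `R(h)v = v ∘ τ_h`. -/
  hR : ∀ (h : G) (v : H), eH (C.R h v) = Lp.compMeasurePreserving (τ h) (hτ h) (eH v)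
  /-- [D4, tex l. 383 / l. 414] `θ_{ω(h)Φ}(g, y) = θ_Φ(g, y·h)`. -/
  hθ : ∀ (h : G) (Φ : SK) (x : X) (y : Y), θ (C.omg h Φ) x y = θ Φ x (τ h y)

attribute [instance] KernelDictionary.instMY

variable {C : IsolationCore H HG CG G SK SigIdx SigIdxG}

/-- **[NODE N21] `invariance`, BY NAME from pv05-g2 `KernelOperatorFD.evalT_comp_eq` through the dictionary:**
`𝒯_{ω(h)Φ}(R(h)v) = 𝒯_Φ(v)` for all `h ∈ U(W)(𝔸)`, `Φ ∈ 𝒮^κ`, `v ∈ L²([U(W)])` ([PerL] v5 ll. 382–383) — exactly the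
type of the field `ArchCDatum.invariance` / `FockAnalyticBridge.invariance`. -/
theorem KernelDictionary.invariance (K : KernelDictionary C) (h : G) (Φ : SK) (v : H) :
    C.TΦc (C.omg h Φ) (C.R h v) = C.TΦc Φ v :=
  K.eCG_injective (funext fun x => by
    rw [K.hT, K.hT, K.hR]
    exact KernelOperatorFD.evalT_comp_eq K.ν (K.hτ h) (K.hτe h) (K.hθ h Φ) (K.eH v) x)

/-- The field in the curried shape `∀ h Φ v, …` in which `ArchCDatum` / `FockAnalyticBridge` state it. -/
theorem KernelDictionary.invariance_field (K : KernelDictionary C) :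
    ∀ (h : G) (Φ : SK) (v : H), C.TΦc (C.omg h Φ) (C.R h v) = C.TΦc Φ v :=
  K.invariance

/-! ## §2 Non-vacuity: the dictionary is inhabited over Prior's one-point core

Prior's frozen smoke `SmokeS4.core` (H = HG = CG = ℂ, G = SK = Unit, `R = 1`, `𝒯 = id`) admits the dictionary
`X = Y = Unit`, `ν` = the Dirac mass, `eH v` = the constant class `v`, `θ ≡ 1`, `τ_h = id`: the kernel integral is
`∫ 1·v dδ = v = (𝒯 v)`.  So `KernelDictionary.invariance` is not a statement about the empty type. -/

namespace KernelDictionarySmoke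

/-- The constant `L²`-class with value `v` on the one-point probability space. -/
def constLp (v : ℂ) : Lp ℂ 2 (Measure.dirac ()) := (memLp_const v).toLp _

/-- (Ported verbatim from the HodgeCMPerL package; no docstring in the source.) -/
theorem evalT_const (θ₀ v : ℂ) (x : Unit) :
    KernelOperatorFD.evalT (fun (_ : Unit) (_ : Unit) => θ₀) (Measure.dirac ()) (constLp v) x = θ₀ * v := by
  rw [KernelOperatorFD.evalT_def]
  have hae : (constLp v : Unit → ℂ) =ᵐ[Measure.dirac ()] fun _ => v := MemLp.coeFn_toLp _
  calc ∫ y, θ₀ * (constLp v) y ∂(Measure.dirac ())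
      = ∫ _y, θ₀ * v ∂(Measure.dirac ()) :=
        integral_congr_ae (by filter_upwards [hae] with y hy; rw [hy])
    _ = θ₀ * v := integral_dirac _ _

/-- **The dictionary over `SmokeS4.core`** — every field PROVED. -/
def dict : KernelDictionary SmokeS4.core where
  X := Unit
  eCG := fun c _ => c
  eCG_injective := fun _ _ h => congrFun h ()
  Y := Unit
  ν := Measure.dirac ()
  eH := constLp
  θ := fun _ _ _ => 1
  hT := fun _ v x => by
    show v = KernelOperatorFD.evalT (fun (_ : Unit) (_ : Unit) => (1 : ℂ)) (Measure.dirac ()) (constLp v) x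
    rw [evalT_const, one_mul]
  τ := fun _ => id
  hτ := fun _ => MeasurePreserving.id _
  hτe := fun _ => MeasurableEmbedding.id
  hR := fun _ v => by
    show constLp v = Lp.compMeasurePreserving id (MeasurePreserving.id _) (constLp v)
    rw [Lp.compMeasurePreserving_id_apply]
  hθ := fun _ _ _ _ => rfl

/-- (Ported verbatim from the HodgeCMPerL package; no docstring in the source.) -/
theorem nonempty_dict : Nonempty (KernelDictionary SmokeS4.core) := ⟨dict⟩

/-- Read-back: the by-name discharge applied to the instance. -/
theorem invariance_fires (h Φ : Unit) (v : ℂ) :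
    SmokeS4.core.TΦc (SmokeS4.core.omg h Φ) (SmokeS4.core.R h v) = SmokeS4.core.TΦc Φ v :=
  dict.invariance h Φ v

end KernelDictionarySmoke

end ArchC
end PerL34
end HodgeCM

end
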